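import Mathlib
import Summits.PneNP.PneNP.Theses.OverlapGapAlgebra
import Summits.PneNP.PneNP.Theorems.OverlapGapAlgebraSolvableImpliesStableSectionTwoWayRepairAssembly
import Summits.PneNP.PneNP.Theorems.OverlapGapAlgebraSolvableImpliesStableSectionUnitClauseAssembly

/-!
# PneNP / OverlapGapAlgebra — crux `SolvableImpliesStableSection` (stmt-PneNP-2463):
# the UNIT CLAUSE block — the crux off / on its core, with the unit-clause threshold as the edge

Support for crux `stmt-PneNP-2463` (`Summit.PneNP.PneNP.Theses.OverlapGapAlgebra.SolvableImpliesStableSection`).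
With the unit-clause block (`sissU_conclusion_of_threshold`) the f-free part of the crux is complete up
to the Chao–Franco threshold: the implication of the crux at `(k, α, η, ν)` (`k ≥ 3`, `α, η, ν > 0`) is a
THEOREM whenever `α·(k²-k)·2M_k < 2^k` (`M_k = (k-2)^{k-2}/(k-1)^{k-1}`, i.e. `α < α_UC(k)`), or
`α ≥ 2^k log 2`, or `η ≥ 1`, or `ν > 2^{-k}`, or `ν > 2^{-k}(e^{kα2^{-k}} - 1)`.  Hence the crux, as typed,
is EQUIVALENT to its restriction to the new core
`{α_UC(k) ≤ α < 2^k log 2} ∩ {η < 1} ∩ {ν ≤ 2^{-k} min(1, e^{kα2^{-k}} - 1)}` — the previous edge was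
`2^k/(4k)` (`sissW_solvableImpliesStableSection_iff_core`), a factor `≈ 5.4` lower.

* `sissU_solvableImpliesStableSection_off_core`, `sissU_solvableImpliesStableSection_iff_core`.
No new definitions; axioms `propext`, `Classical.choice`, `Quot.sound`.
-/

set_option linter.dupNamespace false -- `Summit.PneNP.PneNP.…`: summit = sub-problem (D-0017)

namespace Summit.PneNP.PneNP.Theorems

open Finset Filter
open scoped Classical

section Core

/-- **The crux off the new core region.** For every `k ≥ 3` and `α, η, ν > 0` with `α` below the
unit-clause threshold (`α·(k²-k)·2M_k < 2^k`), or `α ≥ 2^k log 2`, or `η ≥ 1`, or `ν > 2^{-k}`, or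
`ν > 2^{-k}(e^{kα2^{-k}} - 1)`, the implication of `SolvableImpliesStableSection` at `(k, α, η, ν)` holds. -/
theorem sissU_solvableImpliesStableSection_off_core (k : ℕ) (hk : 3 ≤ k) (α η ν : ℝ) (hα : 0 < α)
    (hη : 0 < η) (hν : 0 < ν)
    (hoff : α * ((k * k - k : ℕ) : ℝ) * (2 * (((k : ℝ) - 2) ^ (k - 2) / ((k : ℝ) - 1) ^ (k - 1))) < (2 : ℝ) ^ k ∨
      (2 : ℝ) ^ k * Real.log 2 ≤ α ∨ 1 ≤ η ∨ (1 / 2 : ℝ) ^ k < ν ∨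
      (1 / 2 : ℝ) ^ k * (Real.exp (k * α * (1 / 2 : ℝ) ^ k) - 1) < ν)
    (hsolv : ∃ f : List Bool → List Bool, Literature.Computability.Complexity.IsPolyTime f ∧
      ∃ ε : ℝ, 0 < ε ∧ ∃ᶠ n : ℕ in Filter.atTop, ∀ m : ℕ, m = ⌊α * n⌋₊ → ε ≤
        ((Finset.univ.filter fun Φ : Fin m → Fin k → Fin n × Bool => ∀ i, ∃ j,
          (f (Literature.Computability.Complexity.encodingCNF.encode (List.ofFn fun a =>
            List.ofFn fun b => (((Φ a b).1 : ℕ), (Φ a b).2)))).getD (Φ i j).1 false =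
              (Φ i j).2).card : ℝ) / Fintype.card (Fin m → Fin k → Fin n × Bool))
    (c : ℝ) (hc : 0 < c) :
    ∃ᶠ n : ℕ in Filter.atTop, ∀ m : ℕ, m = ⌊α * n⌋₊ →
      ∃ g : (Fin m → Fin k → Fin n × Bool) → (Fin n → Bool),
        Real.exp (-(c * n)) * Fintype.card (Fin (k + 1) → Fin m → Fin k → Fin n × Bool) ≤
        ((Finset.univ.filter fun Ψ : Fin (k + 1) → Fin m → Fin k → Fin n × Bool =>
          let P : Fin k → ℕ → Fin m → Fin k → Fin n × Bool :=
            fun r q a b => if (a : ℕ) * k + b < q then Ψ r.succ a b else Ψ r.castSucc a b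
          (∀ r : Fin k, ∀ q ≤ m * k, ((Finset.univ.filter fun i : Fin m =>
            ∀ j, g (P r q) (P r q i j).1 ≠ (P r q i j).2).card : ℝ) ≤ ν * m) ∧
          ∀ r : Fin k, ∀ q < m * k,
            (hammingDist (g (P r q)) (g (P r (q + 1))) : ℝ) ≤ η * n).card : ℝ) := by
  rcases hoff with hUC | hrest
  · exact (sissU_conclusion_of_threshold k hk α η ν hα hUC hη hν c hc).frequently
  · exact sissW_solvableImpliesStableSection_off_core k hk α η ν hα hη hν (Or.inr hrest) hsolv c hc

/-- **The crux is equivalent to its new core.** `SolvableImpliesStableSection` holds iff it holds for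
every `k ≥ 3` and `α, η, ν > 0` INSIDE the core region `2^k ≤ α·(k²-k)·2M_k` (`α ≥ α_UC(k)`),
`α < 2^k log 2`, `η < 1`, `ν ≤ 2^{-k}`, `ν ≤ 2^{-k}(e^{kα2^{-k}} - 1)`; off the core it is the theorem
`sissU_solvableImpliesStableSection_off_core`. -/
theorem sissU_solvableImpliesStableSection_iff_core :
    Summit.PneNP.PneNP.Theses.OverlapGapAlgebra.SolvableImpliesStableSection ↔
    (∀ k : ℕ, 3 ≤ k → ∀ α η ν : ℝ, 0 < α → 0 < η → 0 < ν →
      (2 : ℝ) ^ k ≤ α * ((k * k - k : ℕ) : ℝ) * (2 * (((k : ℝ) - 2) ^ (k - 2) / ((k : ℝ) - 1) ^ (k - 1))) →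
      α < (2 : ℝ) ^ k * Real.log 2 → η < 1 → ν ≤ (1 / 2 : ℝ) ^ k →
      ν ≤ (1 / 2 : ℝ) ^ k * (Real.exp (k * α * (1 / 2 : ℝ) ^ k) - 1) →
      (∃ f : List Bool → List Bool, Literature.Computability.Complexity.IsPolyTime f ∧ ∃ ε : ℝ, 0 < ε ∧ ∃ᶠ n : ℕ in Filter.atTop, ∀ m : ℕ, m = ⌊α * n⌋₊ → ε ≤ ((Finset.univ.filter fun Φ : Fin m → Fin k → Fin n × Bool => ∀ i, ∃ j, (f (Literature.Computability.Complexity.encodingCNF.encode (List.ofFn fun a => List.ofFn fun b => (((Φ a b).1 : ℕ), (Φ a b).2)))).getD (Φ i j).1 false = (Φ i j).2).card : ℝ) / Fintype.card (Fin m → Fin k → Fin n × Bool)) →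
      ∀ c : ℝ, 0 < c → ∃ᶠ n : ℕ in Filter.atTop, ∀ m : ℕ, m = ⌊α * n⌋₊ → ∃ g : (Fin m → Fin k → Fin n × Bool) → (Fin n → Bool), Real.exp (-(c * n)) * Fintype.card (Fin (k + 1) → Fin m → Fin k → Fin n × Bool) ≤ ((Finset.univ.filter fun Ψ : Fin (k + 1) → Fin m → Fin k → Fin n × Bool => let P : Fin k → ℕ → Fin m → Fin k → Fin n × Bool := fun r q a b => if (a : ℕ) * k + b < q then Ψ r.succ a b else Ψ r.castSucc a b; (∀ r : Fin k, ∀ q ≤ m * k, ((Finset.univ.filter fun i : Fin m => ∀ j, g (P r q) (P r q i j).1 ≠ (P r q i j).2).card : ℝ) ≤ ν * m) ∧ ∀ r : Fin k, ∀ q < m * k, (hammingDist (g (P r q)) (g (P r (q + 1))) : ℝ) ≤ η * n).card : ℝ)) := by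
  constructor
  · intro h k hk α η ν hα hη hν _ _ _ _ _ hsolv c hc
    exact h k hk α η ν hα hη hν hsolv c hc
  · intro hcore
    unfold Summit.PneNP.PneNP.Theses.OverlapGapAlgebra.SolvableImpliesStableSection
    intro k hk α η ν hα hη hν hsolv c hc
    by_cases h1 : (2 : ℝ) ^ k ≤ α * ((k * k - k : ℕ) : ℝ) * (2 * (((k : ℝ) - 2) ^ (k - 2) / ((k : ℝ) - 1) ^ (k - 1)))
    · by_cases h2 : α < (2 : ℝ) ^ k * Real.log 2
      · by_cases h3 : η < 1
        · by_cases h4 : ν ≤ (1 / 2 : ℝ) ^ k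
          · by_cases h5 : ν ≤ (1 / 2 : ℝ) ^ k * (Real.exp (k * α * (1 / 2 : ℝ) ^ k) - 1)
            · exact hcore k hk α η ν hα hη hν h1 h2 h3 h4 h5 hsolv c hc
            · exact sissU_solvableImpliesStableSection_off_core k hk α η ν hα hη hν
                (Or.inr (Or.inr (Or.inr (Or.inr (not_le.1 h5))))) hsolv c hc
          · exact sissU_solvableImpliesStableSection_off_core k hk α η ν hα hη hν
              (Or.inr (Or.inr (Or.inr (Or.inl (not_le.1 h4))))) hsolv c hc
        · exact sissU_solvableImpliesStableSection_off_core k hk α η ν hα hη hν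
            (Or.inr (Or.inr (Or.inl (not_lt.1 h3)))) hsolv c hc
      · exact sissU_solvableImpliesStableSection_off_core k hk α η ν hα hη hν
          (Or.inr (Or.inl (not_lt.1 h2))) hsolv c hc
    · exact sissU_solvableImpliesStableSection_off_core k hk α η ν hα hη hν
        (Or.inl (not_le.1 h1)) hsolv c hc

end Core

end Summit.PneNP.PneNP.Theorems
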